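import Summits.ABC.ABC.Theorems.TwistAmplificationSharpModerateLawCuspDispersionResolvedDefs

/-!
# Crux `TwistAmplification.SharpModerateLaw` (stmt-ABC-1975), line `deep-moduli-cusp-dispersion`:
the two thick regimes' open core as ONE conductor-free class sum (definitions only)

Worker W6 of lead `prover-line-stmt-ABC-1975-c2-0` (wave 2), 2026-08-16. Companion to
`…CuspDispersionResolvedDefs.lean` (`tube`, `cuspBox`, `resolvedClass`, `ResolvedMissingTw`).

The two thick stubs of the line, `stub_resolvedRegime : … → LawOn ResolvedRegimeTw` (twist-aware thick tube,
`r' ≥ Y^{1/6}`) and `stub_deepRegime : … → LawOn DeepRegimeTw` (twist-aware thick tube, `r' < Y^{1/6}`), are both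
open analytic problems; together they are exactly `LawOn ThickTw` (`ThickTw = ResolvedRegimeTw ∨ DeepRegimeTw`). This
file names their common open core in the conductor-free form a dispersion argument consumes:

* `thickClass e g X Y` — the THICK class of the datum `(e, g)`: `resolvedClass e g X Y` with the predicate
  `ResolvedRegimeTw` relaxed to `ThickTw` and the `r'`-threshold inequality `Y^{1/6}·e·g ≤ |Δ|` deleted, keeping the
  single conductor-free inequality `|Δ|·rad e·(rad g)² ≤ e·g·X` that stands in for `N* ≤ X`
  (`resolvedClass_subset_thickClass`; deep pairs lie in the thick class of their datum as well);
* `ThickMissingTw` — THE NAMED OPEN CORE of stubs 3–4 jointly: the sum over powerful `e ≤ Y` and `g ≤ Y` of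
  `#thickClass e g X Y` obeys the law `C X^ε (X·Y^{-1/6} + 1)` on the cone `X³ ≤ 8Y ≤ 8X^σ`.

Directions (kernel-checked in `…SharpModerateLawThickReduction.lean`): `ThickMissingTw → LawOn ThickTw`
(`lawOn_thickTw_of_thickMissing`, hence `→ LawOn ResolvedRegimeTw`, `→ LawOn DeepRegimeTw`, `→ ResolvedMissingTw`), and
conversely `LawOn ThickTw → ThickMissingTw` (`thickMissingTw_of_lawOn_thickTw`: every class sits inside the thick set at
the SAME scales since `N* = rad(c)·(rad g)² ≤ rad e·(rad g)²·|Δ|/(e g) ≤ X` for a member, and the multiplicity of a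
pair in the double class sum is `≤ d(|Δ|)² = X^{o(1)}`). So `ThickMissingTw` is EQUIVALENT to the pair of thick regime
laws up to `X^ε`: one typed target for the planner, not a stronger bet.
-/

noncomputable section

set_option linter.dupNamespace false

namespace Summit.ABC.ABC.Theorems.SharpModerateLaw.CuspDispersion

open scoped BigOperators

/-! ## 1. The thick class of a datum -/

/-- The THICK class of the datum `(e, g)` at scales `(X, Y)`: pairs of the conductor-free cusp box in the
twist-aware thick tube with `Δ = (u³−v²)/1728 = g·c`, `(u, c) = 1`, every prime of `g` dividing `u`, `e ∣ c`, and
the single conductor-free inequality `|Δ|·rad e·(rad g)² ≤ e·g·X` standing in for `N* ≤ X` (no `r'`-threshold: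
`resolvedClass e g X Y ⊆ thickClass e g X Y`, and deep pairs lie in the thick class of their datum as well). -/
def thickClass (e g : ℕ) (X Y : ℝ) : Set (ℤ × ℤ) :=
  {x | x ∈ cuspBox Y ∧ ThickTw Y x ∧ (∀ p ∈ g.primeFactors, (p : ℤ) ∣ x.1) ∧
    (∃ c : ℤ, (x.1 ^ 3 - x.2 ^ 2) / 1728 = g * c ∧ IsCoprime x.1 c ∧ (e : ℤ) ∣ c) ∧
    ((|x.1 ^ 3 - x.2 ^ 2| : ℤ) : ℝ) / 1728 * ((∏ p ∈ e.primeFactors, p : ℕ) : ℝ) *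
        ((∏ p ∈ g.primeFactors, p : ℕ) : ℝ) ^ 2 ≤ (e : ℝ) * (g : ℝ) * X}

/-- `resolvedClass e g X Y ⊆ thickClass e g X Y` (drop the `r'`-threshold; `ResolvedRegimeTw → ThickTw` is `.1`). -/
theorem resolvedClass_subset_thickClass (e g : ℕ) (X Y : ℝ) : resolvedClass e g X Y ⊆ thickClass e g X Y :=
  fun _ ⟨hbox, hres, hg, hc, _, hN⟩ => ⟨hbox, hres.1, hg, hc, hN⟩

/-! ## 2. The named open core of the two thick stubs -/

/-- **`ThickMissingTw`** — the two thick regime laws (`LawOn ResolvedRegimeTw`, `LawOn DeepRegimeTw`, i.e.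
`LawOn ThickTw`) as ONE CONDUCTOR-FREE CLASS SUM: for `σ > 6`, `ε > 0` there is `C` with, on the cone `X, Y ≥ 1`,
`X³ ≤ 8Y`, `Y ≤ X^σ`, `Σ_{e ≤ Y powerful} Σ_{g ≤ Y} #thickClass e g X Y ≤ C·X^ε·(X·Y^{-1/6} + 1)`.
`ThickMissingTw → LawOn ThickTw` and `LawOn ThickTw → ThickMissingTw` are both proved in the tree
(`…SharpModerateLawThickReduction.lean`), so this is EQUIVALENT to the pair of thick stubs up to `X^ε`. -/
def ThickMissingTw : Prop :=
  ∀ σ : ℝ, 6 < σ → ∀ ε : ℝ, 0 < ε → ∃ C : ℝ, ∀ X Y : ℝ, 1 ≤ X → 1 ≤ Y → X ^ 3 ≤ 8 * Y → Y ≤ X ^ σ →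
    (∑ e ∈ (Finset.Icc 1 ⌊Y⌋₊).filter (fun e : ℕ => ∀ p ∈ e.primeFactors, p ^ 2 ∣ e),
      ∑ g ∈ Finset.Icc 1 ⌊Y⌋₊, (Set.ncard (thickClass e g X Y) : ℝ)) ≤
      C * X ^ ε * (X * Y ^ (-(1 / 6 : ℝ)) + 1)

/-- `ThickMissingTw` unfolded (registration anchor of this definitions file; `Iff.rfl`). -/
theorem thickMissingTw_iff :
    ThickMissingTw ↔
      ∀ σ : ℝ, 6 < σ → ∀ ε : ℝ, 0 < ε → ∃ C : ℝ, ∀ X Y : ℝ, 1 ≤ X → 1 ≤ Y → X ^ 3 ≤ 8 * Y → Y ≤ X ^ σ →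
        (∑ e ∈ (Finset.Icc 1 ⌊Y⌋₊).filter (fun e : ℕ => ∀ p ∈ e.primeFactors, p ^ 2 ∣ e),
          ∑ g ∈ Finset.Icc 1 ⌊Y⌋₊, (Set.ncard (thickClass e g X Y) : ℝ)) ≤
          C * X ^ ε * (X * Y ^ (-(1 / 6 : ℝ)) + 1) :=
  Iff.rfl

end Summit.ABC.ABC.Theorems.SharpModerateLaw.CuspDispersion

end
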